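import Summits.CriticalPhenomena.PercolationContinuityZ3.Theorems.PercAnnulusCrossingIICFarClusterLaw
import Summits.CriticalPhenomena.PercolationContinuityZ3.Theorems.PercAnnulusCrossingIICPairFormulaMin
import Literature.Barriers.CriticalPhenomena.KozmaNachmiasE1
import HarnessLib

/-!
# The law of the LOCAL cluster `C(x; W)` of any site in any window under Kesten's IIC: total variation `≤ ν(0 ↔ x)` from the free law (lane RSW3, p1 gen 23)

builds on p205010 (kernel theorem, internal audit signed; external expert review pending) — NOT used in §1–§3 (every `d ≥ 1`, `p > 0`
with `θ(p) = 0` and one-arm quasi-multiplicativity); §4 at `p_c(ℤ^d)` uses it only through `θ(p_c) = 0`.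

RSW3 lane (LANE 3 `prim-rsw3`), seat `prim-rsw3-p1` (gen 23).  Helper file (`--supports stmt-CriticalPhenomena-4575`); no definitions,
no sorries.  Memo `run/shared/lean/prim/rsw3/P1-QM.md` §36.8.

`…IICClusterLawTV` compared the law of the WHOLE cluster `C(x)` under an IIC measure `ν` with the free law (distance exactly
`ν(x ↔ ∞) − θ_x(p)`).  The census measures clusters inside finite windows.  For a finite window `W` and a site `x` let `C(x; W)` be the
cluster of `x` computed inside `W` (`Literature…clusterIn W x`, Kozma–Nachmias' `C(x; A)`), a random finite subset of `W`.  The event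
`{C(x; W) = C}` (`clusterInIs W x C`) is determined by the pairs of `W` meeting `C` (`DCT16.clusterPairs W C`) and is ANCHORED at `x`: each
such pair that is open on the event has both endpoints joined to `x` (§1; pairs from `C` to `W ∖ C` are closed).  Hence
`…IICFarClusterLaw`'s anchored-events lemma applies:

* `iicMeasure_real_clusterInIs_le` — **`ν(C(x; W) = C) ≤ P_p(C(x; W) = C) + ν(C(x; W) = C, 0 ↔ x)`**;
* `iicMeasure_real_setOf_clusterIn_mem_le` — summed over any class `𝒜`: `ν(C(x;W) ∈ 𝒜) ≤ P_p(C(x;W) ∈ 𝒜) + ν(C(x;W) ∈ 𝒜, 0 ↔ x)`;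
* **`iicMeasure_abs_real_setOf_clusterIn_mem_sub_le`** — since the events `{C(x;W) ∈ 𝒜}`, `{C(x;W) ∈ 𝒜ᶜ}` partition the space:
  **`|ν(C(x; W) ∈ 𝒜) − P_p(C(x; W) ∈ 𝒜)| ≤ ν(0 ↔ x)` for EVERY finite window `W`, every site `x`, every class `𝒜`** — THE LOCAL CLUSTER OF
  ANY SITE, IN ANY WINDOW, UNDER KESTEN'S IIC IS THE FREE ONE UP TO TOTAL VARIATION `ν(0 ↔ x)`, UNIFORMLY IN THE WINDOW (the excess of `ν`
  is carried entirely by `{0 ↔ x}`; e.g. `ν(x isolated in W) ≤ P_p(x isolated in W)`);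
* **`exists_iicMeasure_abs_real_setOf_clusterIn_mem_sub_le_criticalProbI`** — at `p_c(ℤ^d)`, `d ≥ 2`, under (A2)□(s,L) + `CU⁺_l`:
  **`|ν(C(x; W) ∈ 𝒜) − P_{p_c}(C(x; W) ∈ 𝒜)| ≤ C·π_{p_c}(‖x‖_∞)`** (`x ≠ 0`), every `W`, `𝒜` — compare `…IICWindowDensity` (relative error
  `C·π(‖x‖)/π(m)` for ALL events of the window `Λ_x(m)`, degenerating as `m` grows) and `…IICClusterLawTV` (`W = ℤ^d`).
References: H. Kesten, PTRF 73 (1986) Thm. (3); G. Kozma, A. Nachmias, JAMS 24 (2011) §1.6, (5.3); G. Grimmett, *Percolation* (1999) §2.2.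
-/

noncomputable section

namespace Summit.CriticalPhenomena.PercolationContinuityZ3.Theorems.Crossing

open MeasureTheory Filter Topology Literature.Probability.Percolation Literature.Probability.LatticeModels
open Literature.Probability.Percolation.DCT16
open Literature.Barriers.CriticalPhenomena
open Summit.CriticalPhenomena.PercolationContinuityZ3.Theorems.SurfaceTension
open scoped Literature.Probability.Percolation

variable {d : ℕ}

/-! ### §1. `{C(x; W) = C}` is anchored at `x`; the class events -/

/-- **`{C(x; W) = C}` is ANCHORED at `x`**: on the event, a pair of `W` meeting `C` that is an open lattice edge has both endpoints joined to
`x` by open paths (one endpoint lies in `C = C(x; W)`, the other is reached through the edge). [cite: KozmaNachmias2011, §1.6, proof of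
Lemma 5.3 (5.3)] -/
theorem clusterInIs_anchored (W : Finset (Site d)) (x : Site d) (C : Finset (Site d)) :
    ∀ ω ∈ clusterInIs W x C, ω ⊆ (zdGraph d).edgeSet →
      ∀ e ∈ clusterPairs W C, e ∈ ω → ∀ u ∈ e, ω ∈ (openConn x u : Set (BondConfig (Site d))) := by
  classical
  intro ω hω hωE e
  rw [mem_clusterInIs] at hω
  subst hω
  induction e using Sym2.ind with
  | h a b =>
    intro he heω u hu
    have hab : (openGraph ω).Adj a b :=
      (openGraph_adj ω a b).2 ⟨heω, ((SimpleGraph.mem_edgeSet _).1 (hωE heω)).ne⟩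
    have key : ∀ {v w : Site d}, v ∈ clusterIn W x ω → (openGraph ω).Adj v w →
        ω ∈ (openConn x w : Set (BondConfig (Site d))) := fun hv hvw =>
      show (openGraph ω).Reachable x _ from
        (show (openGraph ω).Reachable x _ from mem_openConn_of_mem_clusterIn hv).trans hvw.reachable
    have hor : a ∈ clusterIn W x ω ∨ b ∈ clusterIn W x ω := by
      by_contra h
      push Not at h
      simp only [clusterPairs, Finset.mem_sdiff, Finset.mk_mem_sym2_iff] at he
      exact he.2 ⟨⟨he.1.1, h.1⟩, he.1.2, h.2⟩
    rcases Sym2.mem_iff.1 hu with rfl | rfl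
    · rcases hor with h | h
      · exact mem_openConn_of_mem_clusterIn h
      · exact key h hab.symm
    · rcases hor with h | h
      · exact key h hab
      · exact mem_openConn_of_mem_clusterIn h

/-- The class event `{C(x; W) ∈ 𝒜}` is the finite disjoint union of the `{C(x; W) = C}`, `C ⊆ W`, `C ∈ 𝒜`. [folklore] -/
theorem setOf_clusterIn_mem_eq_biUnion (W : Finset (Site d)) (x : Site d) (𝒜 : Set (Finset (Site d))) [DecidablePred (· ∈ 𝒜)] :
    {ω : BondConfig (Site d) | clusterIn W x ω ∈ 𝒜} = ⋃ C ∈ W.powerset.filter (· ∈ 𝒜), clusterInIs W x C := by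
  ext ω
  simp only [Set.mem_setOf_eq, Set.mem_iUnion, Finset.mem_filter, Finset.mem_powerset, mem_clusterInIs, exists_prop]
  exact ⟨fun h => ⟨clusterIn W x ω, ⟨clusterIn_subset W x ω, h⟩, rfl⟩, fun ⟨C, ⟨_, hC⟩, hωC⟩ => hωC ▸ hC⟩

/-- The events `{C(x; W) = C}` are pairwise disjoint, and so are their traces on any event. [folklore] -/
theorem pairwiseDisjoint_clusterInIs_inter (W : Finset (Site d)) (x : Site d) (T : Finset (Finset (Site d)))
    (G : Set (BondConfig (Site d))) : (↑T : Set (Finset (Site d))).PairwiseDisjoint fun C => clusterInIs W x C ∩ G := by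
  intro C₁ _ C₂ _ hne
  rw [Function.onFun, Set.disjoint_left]
  rintro ω ⟨h₁, -⟩ ⟨h₂, -⟩
  exact hne ((mem_clusterInIs.1 h₁).symm.trans (mem_clusterInIs.1 h₂))

/-- `{C(x; W) ∈ 𝒜}` is measurable. [folklore] -/
theorem measurableSet_setOf_clusterIn_mem (W : Finset (Site d)) (x : Site d) (𝒜 : Set (Finset (Site d))) :
    MeasurableSet {ω : BondConfig (Site d) | clusterIn W x ω ∈ 𝒜} := by
  classical
  rw [setOf_clusterIn_mem_eq_biUnion]
  exact Finset.measurableSet_biUnion _ fun C _ => measurableSet_clusterInIs W x C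

/-- For a finite measure `μ` and any event `G`: `μ({C(x; W) ∈ 𝒜} ∩ G) = Σ_{C ⊆ W, C ∈ 𝒜} μ({C(x; W) = C} ∩ G)`. [folklore] -/
theorem measureReal_setOf_clusterIn_mem_inter_eq_sum (μ : Measure (BondConfig (Site d))) [IsFiniteMeasure μ]
    (W : Finset (Site d)) (x : Site d) (𝒜 : Set (Finset (Site d))) [DecidablePred (· ∈ 𝒜)] {G : Set (BondConfig (Site d))}
    (hG : MeasurableSet G) :
    μ.real ({ω : BondConfig (Site d) | clusterIn W x ω ∈ 𝒜} ∩ G) =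
      ∑ C ∈ W.powerset.filter (· ∈ 𝒜), μ.real (clusterInIs W x C ∩ G) := by
  rw [setOf_clusterIn_mem_eq_biUnion, Set.iUnion₂_inter]
  exact measureReal_biUnion_finset (pairwiseDisjoint_clusterInIs_inter W x _ G)
    fun C _ => (measurableSet_clusterInIs W x C).inter hG

/-! ### §2. The one-sided domination -/

/-- **`ν(C(x; W) = C) ≤ P_p(C(x; W) = C) + ν(C(x; W) = C, 0 ↔ x)`** for every finite measure `ν` with Kesten's IIC limit property at `(d, p)`
(`d ≥ 1`, `p > 0`, `θ(p) = 0`, `OneArmQuasiMultAt d p c`), every finite window `W`, site `x`, value `C`: the anchored-events lemma of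
`…IICFarClusterLaw` with §1. [cite: Kesten1986, Thm. (3), (8)] [cite: KozmaNachmias2011, §1.6] -/
theorem iicMeasure_real_clusterInIs_le (hd : 1 ≤ d) (p : unitInterval) (hp : 0 < (p : ℝ)) (hθ : theta (zdGraph d) 0 p = 0)
    {c : ℝ} (hc : 0 < c) (hQM : OneArmQuasiMultAt d p c) {ν : Measure (BondConfig (Site d))} [IsFiniteMeasure ν]
    (hν : ∀ (F : Finset (Sym2 (Site d))) (E : Set (BondConfig (Site d))), MeasurableSet E → DeterminedBy E ↑F →
      Tendsto (fun n : ℕ => (bondPercolation (zdGraph d) p).real (E ∩ siteToBoundary d n) / oneArmProb d p n)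
        atTop (𝓝 (ν.real E)))
    (W : Finset (Site d)) (x : Site d) (C : Finset (Site d)) :
    ν.real (clusterInIs W x C) ≤ (bondPercolation (zdGraph d) p).real (clusterInIs W x C) +
      ν.real (clusterInIs W x C ∩ (openConn (0 : Site d) x : Set (BondConfig (Site d)))) :=
  iicMeasure_real_le_add_inter_of_anchored hd p hp hθ hc hQM hν (determinedBy_clusterInIs W x C) (clusterInIs_anchored W x C)

/-- **`ν(C(x; W) ∈ 𝒜) ≤ P_p(C(x; W) ∈ 𝒜) + ν(C(x; W) ∈ 𝒜, 0 ↔ x)`** for every class `𝒜` of finite sets (same hypotheses): §2 summed over the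
finitely many values `C ⊆ W`. [cite: Kesten1986, Thm. (3), (8)] -/
theorem iicMeasure_real_setOf_clusterIn_mem_le (hd : 1 ≤ d) (p : unitInterval) (hp : 0 < (p : ℝ)) (hθ : theta (zdGraph d) 0 p = 0)
    {c : ℝ} (hc : 0 < c) (hQM : OneArmQuasiMultAt d p c) {ν : Measure (BondConfig (Site d))} [IsFiniteMeasure ν]
    (hν : ∀ (F : Finset (Sym2 (Site d))) (E : Set (BondConfig (Site d))), MeasurableSet E → DeterminedBy E ↑F →
      Tendsto (fun n : ℕ => (bondPercolation (zdGraph d) p).real (E ∩ siteToBoundary d n) / oneArmProb d p n)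
        atTop (𝓝 (ν.real E)))
    (W : Finset (Site d)) (x : Site d) (𝒜 : Set (Finset (Site d))) :
    ν.real {ω : BondConfig (Site d) | clusterIn W x ω ∈ 𝒜} ≤
      (bondPercolation (zdGraph d) p).real {ω : BondConfig (Site d) | clusterIn W x ω ∈ 𝒜} +
        ν.real ({ω : BondConfig (Site d) | clusterIn W x ω ∈ 𝒜} ∩ (openConn (0 : Site d) x : Set (BondConfig (Site d)))) := by
  classical
  have h1 := measureReal_setOf_clusterIn_mem_inter_eq_sum ν W x 𝒜 MeasurableSet.univ
  have h2 := measureReal_setOf_clusterIn_mem_inter_eq_sum (bondPercolation (zdGraph d) p) W x 𝒜 MeasurableSet.univ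
  have h3 := measureReal_setOf_clusterIn_mem_inter_eq_sum ν W x 𝒜 (measurableSet_openConn_holds 0 x)
  simp only [Set.inter_univ] at h1 h2
  rw [h1, h2, h3, ← Finset.sum_add_distrib]
  exact Finset.sum_le_sum fun C _ => iicMeasure_real_clusterInIs_le hd p hp hθ hc hQM hν W x C

/-! ### §3. Two-sided: total variation `≤ ν(0 ↔ x)` -/

/-- **THE LOCAL CLUSTER OF ANY SITE IN ANY WINDOW UNDER KESTEN'S IIC IS THE FREE ONE UP TO TOTAL VARIATION `ν(0 ↔ x)`**: for every IIC
probability measure `ν` at `(d, p)` (`d ≥ 1`, `p > 0`, `θ(p) = 0`, `OneArmQuasiMultAt d p c`), every finite window `W`, site `x` and class `𝒜`: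
**`|ν(C(x; W) ∈ 𝒜) − P_p(C(x; W) ∈ 𝒜)| ≤ ν(0 ↔ x)`** — §2 for `𝒜` and for `𝒜ᶜ` (the two class events are complementary).
[cite: Kesten1986, Thm. (3), (8)] [cite: KozmaNachmias2011, §1.6] -/
theorem iicMeasure_abs_real_setOf_clusterIn_mem_sub_le (hd : 1 ≤ d) (p : unitInterval) (hp : 0 < (p : ℝ))
    (hθ : theta (zdGraph d) 0 p = 0) {c : ℝ} (hc : 0 < c) (hQM : OneArmQuasiMultAt d p c)
    {ν : Measure (BondConfig (Site d))} [IsProbabilityMeasure ν]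
    (hν : ∀ (F : Finset (Sym2 (Site d))) (E : Set (BondConfig (Site d))), MeasurableSet E → DeterminedBy E ↑F →
      Tendsto (fun n : ℕ => (bondPercolation (zdGraph d) p).real (E ∩ siteToBoundary d n) / oneArmProb d p n)
        atTop (𝓝 (ν.real E)))
    (W : Finset (Site d)) (x : Site d) (𝒜 : Set (Finset (Site d))) :
    |ν.real {ω : BondConfig (Site d) | clusterIn W x ω ∈ 𝒜} -
        (bondPercolation (zdGraph d) p).real {ω : BondConfig (Site d) | clusterIn W x ω ∈ 𝒜}| ≤
      ν.real (openConn (0 : Site d) x) := by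
  set μ := bondPercolation (zdGraph d) p with hμ
  have hup := iicMeasure_real_setOf_clusterIn_mem_le hd p hp hθ hc hQM hν W x 𝒜
  have hlo := iicMeasure_real_setOf_clusterIn_mem_le hd p hp hθ hc hQM hν W x 𝒜ᶜ
  have hcompl : {ω : BondConfig (Site d) | clusterIn W x ω ∈ 𝒜ᶜ} = {ω : BondConfig (Site d) | clusterIn W x ω ∈ 𝒜}ᶜ := by
    ext ω; simp only [Set.mem_setOf_eq, Set.mem_compl_iff]
  have hmeas := measurableSet_setOf_clusterIn_mem W x 𝒜
  rw [hcompl, probReal_compl_eq_one_sub hmeas, ← hμ, probReal_compl_eq_one_sub hmeas] at hlo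
  have hA : ν.real ({ω : BondConfig (Site d) | clusterIn W x ω ∈ 𝒜} ∩ (openConn (0 : Site d) x : Set (BondConfig (Site d)))) ≤
      ν.real (openConn (0 : Site d) x) := measureReal_mono Set.inter_subset_right (measure_ne_top _ _)
  have hB : ν.real ({ω : BondConfig (Site d) | clusterIn W x ω ∈ 𝒜}ᶜ ∩ (openConn (0 : Site d) x : Set (BondConfig (Site d)))) ≤
      ν.real (openConn (0 : Site d) x) := measureReal_mono Set.inter_subset_right (measure_ne_top _ _)
  rw [abs_sub_le_iff]
  constructor <;> linarith

/-! ### §4. At `p_c(ℤ^d)` -/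

/-- **AT `p_c(ℤ^d)`: `|ν(C(x; W) ∈ 𝒜) − P_{p_c}(C(x; W) ∈ 𝒜)| ≤ C·π_{p_c}(‖x‖_∞)`** for every IIC probability measure `ν`, every finite window
`W`, every site `x ≠ 0` and every class `𝒜` (`d ≥ 2`; (A2)□ at aspect `(s,L)`, `2 ≤ s ≤ L`, `ϰ > 0`; `CU⁺_l(c_U)`, `l ≥ 2`, `c_U > 0`;
`θ(p_c) = 0` via p205010): §3 and `ν(0 ↔ x) ≤ C·π(‖x‖)` (`…IICPairFormulaMin`). [cite: Kesten1986, Thm. (3), (8)]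
[cite: BasuSapozhnikov2017ECP, §2 eq. (2.4)] -/
theorem exists_iicMeasure_abs_real_setOf_clusterIn_mem_sub_le_criticalProbI (hd : 2 ≤ d) {s L : ℕ} (hs : 2 ≤ s) (hsL : s ≤ L)
    {ϰ : ℝ} (hϰ : 0 < ϰ) (hA2 : SetToSetQuasiMultAspectAt d (criticalProbI d) s L ϰ) {l : ℕ} (hl : 2 ≤ l) {cU : ℝ} (hcU : 0 < cU)
    (hCU : ∀ a : ℕ, 1 ≤ a → ∀ E : Set (BondConfig (Site d)), IsUpperSet E → MeasurableSet E →
      cU * (bondPercolation (zdGraph d) (criticalProbI d)).real E ≤ (bondPercolation (zdGraph d) (criticalProbI d)).real (E ∩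
        {ω : BondConfig (Site d) | ∀ t ∈ innerBoundary (zdGraph d) (box d a), ∀ s ∈ innerBoundary (zdGraph d) (box d (l * a)),
          ∀ t' ∈ innerBoundary (zdGraph d) (box d a), ∀ s' ∈ innerBoundary (zdGraph d) (box d (l * a)),
          ω ∈ openConnIn (↑((box d (l * a) \ box d a) ∪ innerBoundary (zdGraph d) (box d a)) : Set (Site d)) t s →
          ω ∈ openConnIn (↑((box d (l * a) \ box d a) ∪ innerBoundary (zdGraph d) (box d a)) : Set (Site d)) t' s' →
          ω ∈ openConnIn (↑((box d (l * a) \ box d a) ∪ innerBoundary (zdGraph d) (box d a)) : Set (Site d)) s s'})) :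
    ∃ C : ℝ, 0 < C ∧ ∀ (ν : Measure (BondConfig (Site d))) [IsProbabilityMeasure ν],
      (∀ (F : Finset (Sym2 (Site d))) (E : Set (BondConfig (Site d))), MeasurableSet E → DeterminedBy E ↑F →
        Tendsto (fun n : ℕ => (bondPercolation (zdGraph d) (criticalProbI d)).real (E ∩ siteToBoundary d n) /
          oneArmProb d (criticalProbI d) n) atTop (𝓝 (ν.real E))) →
      ∀ (W : Finset (Site d)) (x : Site d) (𝒜 : Set (Finset (Site d))), x ≠ 0 →
        |ν.real {ω : BondConfig (Site d) | clusterIn W x ω ∈ 𝒜} -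
            (bondPercolation (zdGraph d) (criticalProbI d)).real {ω : BondConfig (Site d) | clusterIn W x ω ∈ 𝒜}| ≤
          C * oneArmProb d (criticalProbI d) (Site.supNorm x) := by
  have hd1 : 1 ≤ d := le_trans (by norm_num) hd
  have hp : 0 < ((criticalProbI d : unitInterval) : ℝ) := by
    rw [coe_criticalProbI]; exact criticalProb_zd_pos d hd1
  have hθ : theta (zdGraph d) 0 (criticalProbI d) = 0 := CSH.percolationContinuity_allDimensions d hd
  obtain ⟨cq, hcq, hQM⟩ := oneArmQuasiMultAt_of_setToSetQuasiMultAspectAt hd hs hsL hϰ hA2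
  obtain ⟨C, hC, h1⟩ := exists_iicMeasure_real_openConn_le_mul_all_criticalProbI hd hs hsL hϰ hA2 hl hcU hCU
  refine ⟨C, hC, fun ν _ hν W x 𝒜 hx0 => ?_⟩
  exact (iicMeasure_abs_real_setOf_clusterIn_mem_sub_le hd1 _ hp hθ hcq hQM hν W x 𝒜).trans (h1 ν hν x hx0)

end Summit.CriticalPhenomena.PercolationContinuityZ3.Theorems.Crossing

end
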